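import Summits.Ventures.CertifiedManyBodySolver.Observables.PairLROTowerWitnessAux
import Summits.Ventures.CertifiedManyBodySolver.Observables.PairLROTowerCeiling
import HarnessLib

/-!
# The tower step with AUXILIARY CONSERVED ROWS (Hamiltonian differences): one torus

HONEST FRAMING: first certified bounds on pairing observables; not a superconductivity verdict. Crew hubbard-obs
(D-0042), seat hubbard-obs-p1 (`prover-hubbard-obs-p1-g14-0`). Zero compute; no definition; no named fact; no `sorry`.

PairLROTowerCeiling's `tower_finite_step` reads a one-point variational bound (OP1)
`c − A + Σ_σ μ_σ(Re⟨ζ,N_σζ⟩/L² − ν) + κ(u − Re⟨ζ,H_Lζ⟩/L²) ≤ −Re⟨ζ,Δ_gζ⟩/L²` (all unit `ζ`) in the Koma–Tasaki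
tower witness. A box / product certificate carries, besides the energy row, LETTER-BOX rows on further densities
(double occupancy, diagonal hopping, …); these are NOT controlled along the tower by any operator identity — but
when the auxiliary observable is a HAMILTONIAN DIFFERENCE `Q_j = (H_L(θ) − H_L(θ_j))/δ_j` (`θ = (t,t',U)`,
`θ_j = (t_j,t'_j,U_j)`; e.g. `U·D_L = H_L(t,t',U+1) − H_L(t,t',U)`), the tower controls it for free:
`Re⟨Ξ,H_L(θ)Ξ⟩ ≤ E + D̄` is the existing energy clause, and `Re⟨Ξ,H_L(θ_j)Ξ⟩ ≥ F_j` for every common SECTOR FLOOR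
`F_j ≤ minEnergyOn H_L(θ_j) (szSector (N+2m) 0)`, `m ≤ k` (the levels `(Δ†)^mψ` of the tower lie in those sectors
and `H_L(θ_j)` conserves `N`: clause (5) of `exists_towerWitness_aux`).
* `pairField_conjTranspose_pow_mulVec_mem_szSector` — `(Δ_g†)^m ψ ∈ szSector (N + 2m) 0` for `ψ ∈ szSector N 0`;
* **`tower_finite_step_aux`** — `tower_finite_step` with the extra LHS terms
  `Σ_j ρ_j (w_j − Re⟨ζ,(H_L(θ) − H_L(θ_j))ζ⟩/(δ_j L²))`, `ρ_j ≥ 0`, `δ_j > 0`: the conclusion acquires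
  `Σ_j ρ_j (w_j − (E/L² − F_j)/δ_j)` inside the bracket and `(Σ_j ρ_j/δ_j)·D̄/L²` in the `O(1/L²)` slack
  (`F_j` a common floor DENSITY of `H_L(θ_j)` on the sectors `(N + 2m, 0)`, `m ≤ k`).
The family / thermodynamic-limit reading is PairLROTowerCeilingAux.lean.
References: T. Koma, H. Tasaki, J. Stat. Phys. 76 (1994) 745, Theorem 5, §4 [KomaTasaki1994]; J. Wang et al.,
PRX 14 (2024) 031006, §III [WangEtAl2024].
-/

noncomputable section

namespace Summit.Ventures.CertifiedManyBodySolver.Observables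

open Matrix Complex Finset Literature.MathematicalPhysics.QuantumLattice Literature.Probability.LatticeModels
open Literature.MathematicalPhysics.QuantumLattice.HubbardWave0 ThermodynamicLimit Filter Topology
open Literature.MathematicalPhysics.QuantumManyBody.StateRelaxation
open scoped ComplexOrder ComplexConjugate BigOperators

/-! ### §0  The tower levels lie in the charge sectors `(N + 2m, S^z = 0)` -/

section Sector

variable {L : ℕ} [NeZero L] (g : Site 2 → ℝ)

/-- An eigenvector of the number operator with a natural eigenvalue is an `N`-particle vector
(`totalNumber` is diagonal in the occupation basis with entries `|s|`). [folklore] -/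
theorem isNParticle_of_totalNumber_mulVec {Λ : Type*} [LinearOrder Λ] [Fintype Λ] {N : ℕ} {ψ : Fock (Orb Λ)}
    (h : totalNumber *ᵥ ψ = (N : ℂ) • ψ) : IsNParticle N ψ := by
  intro s hs
  have h1 := congrFun h s
  rw [LiebTwo.totalNumber_mulVec, Pi.smul_apply, smul_eq_mul] at h1
  have h2 : ((s.card : ℂ) - N) * ψ s = 0 := by rw [sub_mul, h1, sub_self]
  rcases mul_eq_zero.1 h2 with h3 | h3
  · exact absurd (by exact_mod_cast sub_eq_zero.1 h3) hs
  · exact h3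

/-- `S^z` commutes with the adjoint pair field: `S^z Δ_g† − Δ_g† S^z = 0` (`Δ†` raises `N_↑` and `N_↓` by one
each). [cite: KomaTasaki1994, §2.3 (2.16)] -/
theorem spinZ_commutator_pairField_conjTranspose :
    (spinZ : Matrix (Finset (Orb (FermionTorus 2 L))) _ ℂ) * (pairField g L)ᴴ - (pairField g L)ᴴ * spinZ =
      ((0 : ℝ) : ℂ) • (pairField g L)ᴴ := by
  have hN : (totalNumber : Matrix _ _ ℂ) * (pairField g L)ᴴ - (pairField g L)ᴴ * totalNumber =
      ((2 : ℝ) : ℂ) • (pairField g L)ᴴ := by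
    have h := commutator_conjTranspose_of_commutator totalNumber_isHermitian (totalNumber_commutator_pairField g L)
    rw [neg_neg] at h; exact h
  have h0 : (∑ y : FermionTorus 2 L, numberOp y (0 : Fin 2)) * (pairField g L)ᴴ -
      (pairField g L)ᴴ * (∑ y : FermionTorus 2 L, numberOp y (0 : Fin 2)) = ((1 : ℝ) : ℂ) • (pairField g L)ᴴ := by
    have h := commutator_conjTranspose_of_commutator (spinNumber_isHermitian (L := L) 0)
      (spinNumber_commutator_pairField g 0)
    rw [neg_neg] at h; exact h
  have hS : (spinZ : Matrix (Finset (Orb (FermionTorus 2 L))) _ ℂ) =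
      (∑ y : FermionTorus 2 L, numberOp y (0 : Fin 2)) - (1 / 2 : ℂ) • totalNumber := by
    rw [sum_numberOp_eq_half_totalNumber_add_spinZ (0 : Fin 2), if_pos rfl, one_smul]; abel
  rw [hS, sub_mul, mul_sub, Matrix.smul_mul, Matrix.mul_smul]
  have e : (∑ y : FermionTorus 2 L, numberOp y (0 : Fin 2)) * (pairField g L)ᴴ - (1 / 2 : ℂ) • (totalNumber * (pairField g L)ᴴ) -
      ((pairField g L)ᴴ * (∑ y : FermionTorus 2 L, numberOp y (0 : Fin 2)) - (1 / 2 : ℂ) • ((pairField g L)ᴴ * totalNumber)) =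
      ((∑ y : FermionTorus 2 L, numberOp y (0 : Fin 2)) * (pairField g L)ᴴ -
        (pairField g L)ᴴ * (∑ y : FermionTorus 2 L, numberOp y (0 : Fin 2))) -
      (1 / 2 : ℂ) • ((totalNumber : Matrix _ _ ℂ) * (pairField g L)ᴴ - (pairField g L)ᴴ * totalNumber) := by
    rw [smul_sub]; abel
  rw [e, h0, hN, smul_smul]
  push_cast
  rw [← sub_smul]
  norm_num

/-- **The tower levels are sector vectors**: for `ψ ∈ szSector N 0`, `(Δ_g†)^m ψ ∈ szSector (N + 2m) 0`
(`[N, Δ†] = 2Δ†`, `[S^z, Δ†] = 0`). [cite: KomaTasaki1994, §2.3 (2.16)] -/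
theorem pairField_conjTranspose_pow_mulVec_mem_szSector {N : ℕ} {ψ : Fock (Orb (FermionTorus 2 L))}
    (hψ : ψ ∈ szSector N 0) (m : ℕ) : ((pairField g L)ᴴ ^ m) *ᵥ ψ ∈ szSector (N + 2 * m) 0 := by
  obtain ⟨hNψ, hSψ⟩ := (mem_szSector_iff N 0 ψ).1 hψ
  have hNA : (totalNumber : Matrix _ _ ℂ) * (pairField g L)ᴴ - (pairField g L)ᴴ * totalNumber =
      ((2 : ℝ) : ℂ) • (pairField g L)ᴴ := by
    have h := commutator_conjTranspose_of_commutator totalNumber_isHermitian (totalNumber_commutator_pairField g L)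
    rw [neg_neg] at h; exact h
  have hNψ' : (totalNumber : Matrix _ _ ℂ) *ᵥ ψ = ((N : ℝ) : ℂ) • ψ := by
    rw [totalNumber_mulVec_of_isNParticle hNψ]; push_cast; rfl
  refine (mem_szSector_iff (N + 2 * m) 0 _).2 ⟨?_, ?_⟩
  · refine isNParticle_of_totalNumber_mulVec ?_
    rw [tower_charge hNA hNψ' m]
    push_cast
    rfl
  · have h := tower_charge (spinZ_commutator_pairField_conjTranspose g) hSψ m
    rw [h]
    push_cast
    ring_nf

end Sector

/-! ### §1  Real-arithmetic assembly lemmas (kept out of the long tower step to respect the default heartbeat budget) -/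

section Arith

/-- The auxiliary rows at the witness: if `X_j ≤ E + D̄ − F_j` for every `j` (`ρ_j ≥ 0`, `δ_j, L² > 0`), then
`Σ_j ρ_j (w_j − (E/L² − F_j)/δ_j) − (Σ_j ρ_j/δ_j) D̄/L² ≤ Σ_j ρ_j (w_j − X_j/(δ_j L²))` (`X_j ≤ E + D̄ − F_jL²`).
[folklore] -/
theorem aux_rows_witness_le {ι : Type*} [Fintype ι] (ρ δ w F X : ι → ℝ) {E Dbar L2 : ℝ} (hL2 : 0 < L2)
    (hδ : ∀ j, 0 < δ j) (hρ : ∀ j, 0 ≤ ρ j) (hX : ∀ j, X j ≤ E + Dbar - F j * L2) :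
    ∑ j, ρ j * (w j - (E / L2 - F j) / δ j) - (∑ j, ρ j / δ j) * Dbar / L2 ≤
      ∑ j, ρ j * (w j - X j / (δ j * L2)) := by
  have hsplit : ∑ j, ρ j * (w j - (E / L2 - F j) / δ j) - (∑ j, ρ j / δ j) * Dbar / L2 =
      ∑ j, ρ j * (w j - (E + Dbar - F j * L2) / (δ j * L2)) := by
    rw [Finset.sum_mul, Finset.sum_div, ← Finset.sum_sub_distrib]
    refine Finset.sum_congr rfl fun j _ => ?_
    have hδj := (hδ j).ne'
    have hL2' := hL2.ne'
    field_simp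
    ring
  rw [hsplit]
  refine Finset.sum_le_sum fun j _ => mul_le_mul_of_nonneg_left ?_ (hρ j)
  have hδL : 0 < δ j * L2 := mul_pos (hδ j) hL2
  have := div_le_div_of_nonneg_right (hX j) hδL.le
  linarith

/-- Linear assembly of the tower step: the certificate inequality at the witness (`hwin`), the energy
clause (`hen`), the one-point amplitude (`hop`) and the auxiliary rows (`haux`) give the stated ceiling with
the `O(1/L²)` slack collected in one fraction. [folklore] -/
theorem tower_step_assembly {lhs op c A Smu Nh L2 ν κ u E eH Dbar SΞ SEF Sρδ k : ℝ}
    (hwin : c - A + (Smu * (Nh / L2 - ν) + Smu * (k / 2) / L2) + κ * (u - eH / L2) + SΞ ≤ -(op / L2))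
    (hen : κ * (u - E / L2) - κ * Dbar / L2 ≤ κ * (u - eH / L2))
    (hop : lhs ≤ op / L2) (haux : SEF - Sρδ * Dbar / L2 ≤ SΞ) :
    lhs ≤ -(c - A + Smu * (Nh / L2 - ν) + κ * (u - E / L2) + SEF) + (-Smu * k / 2 + (κ + Sρδ) * Dbar) / L2 := by
  have e3 : (-Smu * k / 2 + (κ + Sρδ) * Dbar) / L2 = -(Smu * (k / 2) / L2) + κ * Dbar / L2 + Sρδ * Dbar / L2 := by
    ring
  rw [e3]
  linarith

end Arith

/-! ### §2  One torus: the tower step with auxiliary conserved rows -/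

section Finite

variable {L : ℕ} [NeZero L] (g : Site 2 → ℝ)

/-- **The finite-volume tower step with auxiliary Hamiltonian-difference rows.** Setting of
`tower_finite_step` (unit sector ground state `ψ` of `H = hubbardTorusTT' L t t' U` in `(N, S^z = 0)`, LRO floor
`c₀L⁴ ≤ Re⟨ψ,Δ†Δψ⟩`, the constants `C_α, C_κ, C_γ`, `(k+1)C_γ ≤ (c₀/2)L²`), plus a finite family of auxiliary
parameter points `θ_j = (t_j, t'_j, U_j)` with weights `ρ_j ≥ 0`, scales `δ_j > 0`, targets `w_j` and SECTOR
FLOOR DENSITIES `F_j L² ≤ minEnergyOn H_L(θ_j) (szSector (N + 2m) 0)` for all `m ≤ k`. If the one-point bound with the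
auxiliary rows — (OP1) `+ Σ_j ρ_j (w_j − Re⟨ζ,(H_L(θ) − H_L(θ_j))ζ⟩/(δ_j L²))` on the left — holds for every
unit `ζ`, then
`(k/(k+1))√(c₀ − (k+1)C_γ/L²) ≤ −(c − A + (Σμ)((N/2)/L² − ν) + κ(u − E/L²) + Σ_j ρ_j(w_j − (E/L² − F_j)/δ_j))
 + (−(Σμ)k/2 + (κ + Σ_j ρ_j/δ_j)·D̄)/L²`, `E = minEnergyOn (szSector N 0)`,
`D̄ = (C_κ/√(c₀/2))Σ_{i<k}(C_α/√(c₀/2))^i`. [cite: KomaTasaki1994, Theorem 5 and §4] -/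
theorem tower_finite_step_aux (t t' U : ℝ) {N : ℕ} {ψ : Fock (Orb (FermionTorus 2 L))}
    (hψ1 : star ψ ⬝ᵥ ψ = 1) (hgs : IsGroundStateInSector (hubbardTorusTT' L t t' U) N 0 ψ)
    {c A κ u ν c₀ Cα Cκ Cγ : ℝ} (μ : Fin 2 → ℝ) (hκ : 0 ≤ κ) (hc₀ : 0 < c₀) (hCα : 0 ≤ Cα) (hCκ : 0 ≤ Cκ)
    (hCγ : 0 ≤ Cγ) (k : ℕ)
    {ι : Type*} [Fintype ι] (ta tpa Ua δ ρ w F : ι → ℝ) (hδ : ∀ j, 0 < δ j) (hρ : ∀ j, 0 ≤ ρ j)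
    (hF : ∀ j, ∀ m : ℕ, m ≤ k →
      F j * (L : ℝ) ^ 2 ≤ (hubbardTorusTT' L (ta j) (tpa j) (Ua j)).minEnergyOn (szSector (N + 2 * m) 0))
    (hα : ∀ φ : Fock (Orb (FermionTorus 2 L)),
      eucNorm ((pairField g L)ᴴ *ᵥ φ) ≤ Cα * (L : ℝ) ^ 2 * eucNorm φ)
    (hκ' : ∀ φ : Fock (Orb (FermionTorus 2 L)),
      eucNorm ((hubbardTorusTT' L t t' U * (pairField g L)ᴴ - (pairField g L)ᴴ * hubbardTorusTT' L t t' U) *ᵥ φ) ≤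
        Cκ * (L : ℝ) ^ 2 * eucNorm φ)
    (hγ : ∀ φ : Fock (Orb (FermionTorus 2 L)), star φ ⬝ᵥ φ = 1 →
      |(expect (pairField g L * (pairField g L)ᴴ - (pairField g L)ᴴ * pairField g L) φ).re| ≤ Cγ * (L : ℝ) ^ 2)
    (hlro : c₀ * (L : ℝ) ^ 4 ≤ (expect ((pairField g L)ᴴ * pairField g L) ψ).re)
    (hLbig : (k + 1) * Cγ ≤ (c₀ / 2) * (L : ℝ) ^ 2)
    (hbound : ∀ ζ : Fock (Orb (FermionTorus 2 L)), star ζ ⬝ᵥ ζ = 1 →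
      c - A + ∑ σ : Fin 2, μ σ *
          ((star ζ ⬝ᵥ ((∑ y : FermionTorus 2 L, numberOp y σ) *ᵥ ζ)).re / (L : ℝ) ^ 2 - ν) +
        κ * (u - (star ζ ⬝ᵥ (hubbardTorusTT' L t t' U *ᵥ ζ)).re / (L : ℝ) ^ 2) +
        ∑ j, ρ j * (w j -
          (star ζ ⬝ᵥ ((hubbardTorusTT' L t t' U - hubbardTorusTT' L (ta j) (tpa j) (Ua j)) *ᵥ ζ)).re /
            (δ j * (L : ℝ) ^ 2)) ≤
        -((expect (pairField g L) ζ).re / (L : ℝ) ^ 2)) :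
    (k : ℝ) / (k + 1) * Real.sqrt (c₀ - (k + 1) * Cγ / (L : ℝ) ^ 2) ≤
      -(c - A + (∑ σ : Fin 2, μ σ) * (((N : ℝ) / 2) / (L : ℝ) ^ 2 - ν) +
          κ * (u - (hubbardTorusTT' L t t' U).minEnergyOn (szSector N 0) / (L : ℝ) ^ 2) +
          ∑ j, ρ j * (w j -
            ((hubbardTorusTT' L t t' U).minEnergyOn (szSector N 0) / (L : ℝ) ^ 2 - F j) / δ j)) +
        (-(∑ σ : Fin 2, μ σ) * k / 2 +
          (κ + ∑ j, ρ j / δ j) *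
            ((Cκ / Real.sqrt (c₀ / 2)) * ∑ i ∈ Finset.range k, (Cα / Real.sqrt (c₀ / 2)) ^ i)) / (L : ℝ) ^ 2 := by
  set H := hubbardTorusTT' L t t' U with hH
  set P := pairField g L with hP
  set E : ℝ := H.minEnergyOn (szSector N 0) with hE
  have hL : (0 : ℝ) < (L : ℝ) := Nat.cast_pos.2 (Nat.pos_of_ne_zero (NeZero.ne L))
  have hL2 : (0 : ℝ) < (L : ℝ) ^ 2 := by positivity
  have hHN : H * totalNumber = totalNumber * H := (hubbardTorusTT'_commute_totalNumber L t t' U).eq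
  have hNA : (totalNumber : Matrix _ _ ℂ) * Pᴴ - Pᴴ * totalNumber = ((2 : ℝ) : ℂ) • Pᴴ := by
    have h := commutator_conjTranspose_of_commutator totalNumber_isHermitian (totalNumber_commutator_pairField g L)
    rw [neg_neg] at h; exact h
  have hHψ : H *ᵥ ψ = (E : ℂ) • ψ := hgs.2.2
  have hNψ : (totalNumber : Matrix _ _ ℂ) *ᵥ ψ = ((N : ℝ) : ℂ) • ψ := by
    rw [totalNumber_mulVec_of_isNParticle ((mem_szSector_iff _ _ ψ).1 hgs.1).1]; push_cast; rfl
  set α : ℝ := Cα * (L : ℝ) ^ 2 with hαdef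
  set κ₁ : ℝ := Cκ * (L : ℝ) ^ 2 with hκ₁def
  set β : ℝ := Cγ * (L : ℝ) ^ 2 with hβdef
  have hα0 : 0 ≤ α := mul_nonneg hCα hL2.le
  have hκ₁0 : 0 ≤ κ₁ := mul_nonneg hCκ hL2.le
  have hβ0 : 0 ≤ β := mul_nonneg hCγ hL2.le
  have hβ' : ∀ φ : Fock (Orb (FermionTorus 2 L)),
      |(star φ ⬝ᵥ ((Pᴴ * Pᴴᴴ - Pᴴᴴ * Pᴴ) *ᵥ φ)).re| ≤ β * eucNorm φ ^ 2 := by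
    intro φ
    rw [conjTranspose_conjTranspose]
    have hunit : ∀ ψ' : Fock (Orb (FermionTorus 2 L)), star ψ' ⬝ᵥ ψ' = 1 →
        |(star ψ' ⬝ᵥ ((Pᴴ * P - P * Pᴴ) *ᵥ ψ')).re| ≤ β := by
      intro ψ' h1
      have h := hγ ψ' h1
      have e : (Pᴴ * P - P * Pᴴ) = -(P * Pᴴ - Pᴴ * P) := by abel
      rw [e, neg_mulVec, dotProduct_neg, Complex.neg_re, abs_neg]
      exact h
    exact abs_re_quadForm_le_of_unit hunit φ
  set ρ₀ : ℝ := (L : ℝ) ^ 2 * Real.sqrt (c₀ - (k + 1) * Cγ / (L : ℝ) ^ 2) with hρdef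
  have hinside : c₀ / 2 ≤ c₀ - (k + 1) * Cγ / (L : ℝ) ^ 2 := by
    have h1 : (k + 1) * Cγ / (L : ℝ) ^ 2 ≤ c₀ / 2 := by
      rw [div_le_iff₀ hL2]; exact hLbig
    linarith
  have hρpos : 0 < ρ₀ := by
    have : 0 < Real.sqrt (c₀ - (k + 1) * Cγ / (L : ℝ) ^ 2) := Real.sqrt_pos.2 (by linarith)
    exact mul_pos hL2 this
  have hρ2 : ρ₀ ^ 2 + k * β ≤ eucNorm (Pᴴ *ᵥ ψ) ^ 2 := by
    have e1 : eucNorm (Pᴴ *ᵥ ψ) ^ 2 = (expect (P * Pᴴ) ψ).re := by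
      rw [eucNorm_sq, star_mulVec, conjTranspose_conjTranspose, ← dotProduct_mulVec, mulVec_mulVec]; rfl
    have e2 : ρ₀ ^ 2 = c₀ * (L : ℝ) ^ 4 - (k + 1) * Cγ * (L : ℝ) ^ 2 := by
      rw [hρdef, mul_pow, Real.sq_sqrt (by linarith)]
      field_simp
    have h3 : (expect (Pᴴ * P) ψ).re - Cγ * (L : ℝ) ^ 2 ≤ (expect (P * Pᴴ) ψ).re := by
      have h := (abs_le.1 (hγ ψ hψ1)).1
      have e : expect (P * Pᴴ - Pᴴ * P) ψ = expect (P * Pᴴ) ψ - expect (Pᴴ * P) ψ := by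
        simp [Literature.MathematicalPhysics.QuantumLattice.expect, sub_mulVec, dotProduct_sub]
      rw [e, Complex.sub_re] at h
      linarith
    rw [e1, e2, hβdef]
    nlinarith [hlro, h3]
  obtain ⟨Ξ, hΞ1, -, hΞP, hΞH, hΞG, hΞF⟩ := exists_towerWitness_aux totalNumber_isHermitian hHN
    (by norm_num : (2 : ℝ) ≠ 0) hNA hψ1 hHψ hNψ hα0 hα hκ₁0 hκ' hβ0 hβ' k hρpos hρ2
  rw [conjTranspose_conjTranspose] at hΞP
  have hΞN : ∀ σ : Fin 2, (star Ξ ⬝ᵥ ((∑ y : FermionTorus 2 L, numberOp y σ) *ᵥ Ξ)).re = (N : ℝ) / 2 + k / 2 := by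
    intro σ
    have hGA : (∑ y : FermionTorus 2 L, numberOp y σ) * Pᴴ - Pᴴ * (∑ y : FermionTorus 2 L, numberOp y σ) =
        ((1 : ℝ) : ℂ) • Pᴴ := by
      have h := commutator_conjTranspose_of_commutator (spinNumber_isHermitian (L := L) σ)
        (spinNumber_commutator_pairField g σ)
      rw [neg_neg] at h; exact h
    have hGψ := spinNumber_mulVec_of_mem_szSector σ hgs.1
    rw [hΞG _ 1 ((N : ℝ) / 2) hGA hGψ, Complex.ofReal_re]
    ring
  -- the sector floors of the auxiliary Hamiltonians along the tower
  have hΞFj : ∀ j, F j * (L : ℝ) ^ 2 ≤ (star Ξ ⬝ᵥ (hubbardTorusTT' L (ta j) (tpa j) (Ua j) *ᵥ Ξ)).re := by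
    intro j
    refine hΞF _ (F j * (L : ℝ) ^ 2) (hubbardTorusTT'_commute_totalNumber L (ta j) (tpa j) (Ua j)).eq
      fun m hm => ?_
    have hmem := pairField_conjTranspose_pow_mulVec_mem_szSector g hgs.1 m
    have h := minEnergyOn_mul_le_re_rayleigh (hubbardTorusTT'_isHermitian L (ta j) (tpa j) (Ua j))
      (szSector (N + 2 * m) 0) hmem
    rw [eucNorm_sq]
    exact (mul_le_mul_of_nonneg_right (hF j m hm) (by rw [← eucNorm_sq]; positivity)).trans h
  have hwin := hbound Ξ hΞ1
  simp_rw [hΞN] at hwin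
  have hfill : ∑ σ : Fin 2, μ σ * (((N : ℝ) / 2 + k / 2) / (L : ℝ) ^ 2 - ν) =
      (∑ σ : Fin 2, μ σ) * (((N : ℝ) / 2) / (L : ℝ) ^ 2 - ν) + (∑ σ : Fin 2, μ σ) * (k / 2) / (L : ℝ) ^ 2 := by
    rw [Finset.sum_mul, Finset.sum_mul, Finset.sum_div, ← Finset.sum_add_distrib]
    refine Finset.sum_congr rfl fun σ _ => ?_
    field_simp
    ring
  rw [hfill] at hwin
  set Dbar : ℝ := (Cκ / Real.sqrt (c₀ / 2)) * ∑ i ∈ Finset.range k, (Cα / Real.sqrt (c₀ / 2)) ^ i with hDbar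
  have hsqrt_le : (L : ℝ) ^ 2 * Real.sqrt (c₀ / 2) ≤ ρ₀ := by
    rw [hρdef]
    exact mul_le_mul_of_nonneg_left (Real.sqrt_le_sqrt hinside) hL2.le
  have hs0 : 0 < Real.sqrt (c₀ / 2) := Real.sqrt_pos.2 (by linarith)
  have hratio1 : κ₁ / ρ₀ ≤ Cκ / Real.sqrt (c₀ / 2) := by
    rw [hκ₁def, div_le_div_iff₀ hρpos hs0]
    calc Cκ * (L : ℝ) ^ 2 * Real.sqrt (c₀ / 2) = Cκ * ((L : ℝ) ^ 2 * Real.sqrt (c₀ / 2)) := by ring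
      _ ≤ Cκ * ρ₀ := mul_le_mul_of_nonneg_left hsqrt_le hCκ
  have hratio2 : α / ρ₀ ≤ Cα / Real.sqrt (c₀ / 2) := by
    rw [hαdef, div_le_div_iff₀ hρpos hs0]
    calc Cα * (L : ℝ) ^ 2 * Real.sqrt (c₀ / 2) = Cα * ((L : ℝ) ^ 2 * Real.sqrt (c₀ / 2)) := by ring
      _ ≤ Cα * ρ₀ := mul_le_mul_of_nonneg_left hsqrt_le hCα
  have hDbar0 : 0 ≤ Dbar := by
    rw [hDbar]
    exact mul_nonneg (div_nonneg hCκ hs0.le) (Finset.sum_nonneg fun i _ => pow_nonneg (div_nonneg hCα hs0.le) i)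
  have hD_le : (κ₁ / ρ₀) * ∑ i ∈ Finset.range k, (α / ρ₀) ^ i ≤ Dbar := by
    rw [hDbar]
    refine mul_le_mul hratio1 (Finset.sum_le_sum fun i _ => ?_)
      (Finset.sum_nonneg fun i _ => pow_nonneg (div_nonneg hα0 hρpos.le) i) (div_nonneg hCκ hs0.le)
    exact pow_le_pow_left₀ (div_nonneg hα0 hρpos.le) hratio2 i
  have heΞ : (star Ξ ⬝ᵥ (H *ᵥ Ξ)).re ≤ E + Dbar := hΞH.trans (by linarith)
  have hone : (k : ℝ) / (k + 1) * ρ₀ ≤ (expect P Ξ).re := hΞP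
  have hρL : ρ₀ / (L : ℝ) ^ 2 = Real.sqrt (c₀ - (k + 1) * Cγ / (L : ℝ) ^ 2) := by
    rw [hρdef]; field_simp
  have hen : κ * (u - E / (L : ℝ) ^ 2) - κ * Dbar / (L : ℝ) ^ 2 ≤
      κ * (u - (star Ξ ⬝ᵥ (H *ᵥ Ξ)).re / (L : ℝ) ^ 2) := by
    have h1 : (star Ξ ⬝ᵥ (H *ᵥ Ξ)).re / (L : ℝ) ^ 2 ≤ E / (L : ℝ) ^ 2 + Dbar / (L : ℝ) ^ 2 := by
      rw [← add_div]; exact div_le_div_of_nonneg_right heΞ hL2.le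
    have h2 := mul_le_mul_of_nonneg_left h1 hκ
    rw [mul_add] at h2
    have e : κ * Dbar / (L : ℝ) ^ 2 = κ * (Dbar / (L : ℝ) ^ 2) := by ring
    rw [e]
    linarith
  -- the auxiliary rows at the witness
  have hX : ∀ j, (star Ξ ⬝ᵥ ((H - hubbardTorusTT' L (ta j) (tpa j) (Ua j)) *ᵥ Ξ)).re ≤
      E + Dbar - F j * (L : ℝ) ^ 2 := by
    intro j
    rw [sub_mulVec, dotProduct_sub, Complex.sub_re]
    linarith [heΞ, hΞFj j]
  have haux := aux_rows_witness_le ρ δ w F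
    (fun j => (star Ξ ⬝ᵥ ((H - hubbardTorusTT' L (ta j) (tpa j) (Ua j)) *ᵥ Ξ)).re) hL2 hδ hρ hX
  beta_reduce at haux
  have hop : (k : ℝ) / (k + 1) * Real.sqrt (c₀ - (k + 1) * Cγ / (L : ℝ) ^ 2) ≤ (expect P Ξ).re / (L : ℝ) ^ 2 := by
    rw [← hρL, ← mul_div_assoc]
    exact div_le_div_of_nonneg_right hone hL2.le
  exact tower_step_assembly hwin hen hop haux

end Finite

end Summit.Ventures.CertifiedManyBodySolver.Observables

end
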